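import Mathlib

/-!
# Lift-off far field and uniqueness of the bounded smoothing inverse — kernel #113 (solo-blind s63)

Two appendices to kernels #111 (`SoloBlindLiftoffInner`) and #112 (`SoloBlindSmoothingGreen`).

**A. Far field of the explicit lift-off solution.** The right branch of the leading-order
lift-off amplitude is `Q(η) = η³ + 3η - 4` (kernel #111); the outer solution it must match is the
pure cubic `η³`. The ratio `Q/η³ = 1 + 3/η² - 4/η³` vanishes at the contact `η = 1`, crosses `1`
at `η = 4/3`, is MAXIMAL `= 5/4` at `η = 2` (it overshoots: the multiplicative composite
`outer × [Q/η³]₊` over-lifts the amplitude by up to `√(5/4) - 1 ≈ 11.8 %`), increases on `(0, 2]`,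
decreases on `[2, ∞)`, and `|Q/η³ - 1| ≤ 3/η²` exactly for `η ≥ 2/3` (the relative approach to
the outer cubic is only `O(η⁻²)`). All of this is certified below by closed-form identities.

**B. No bounded homogeneous solutions.** The real solutions of `m''' = m` produced by the three
roots of `k³ = 1` are `a e^{η} + e^{-η/2} (b cos(√3 η/2) + c sin(√3 η/2))` (kernel #112 certifies
that these modes are their own third derivatives). We prove: if such a function is bounded on
`ℝ`, then `a = b = c = 0` — `e^{η}` is unbounded at `+∞`, the oscillatory modes at `-∞` (evaluated
where the phase is a multiple of `2π`, resp. `π/2` mod `2π`). Hence the bounded Green's function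
of `1 - ∂³` of kernel #112 is the unique bounded inverse within this solution family (that every
`C³` solution of `m''' = m` lies in the family is the standard dimension count, not formalised).
-/

namespace Summit.AnomalousDissipation.AnomalousDissipation.Theorems

open Real

/-! ## A. Far field of `Q(η) = η³ + 3η - 4` against the outer cubic `η³` -/

/-- `Q/η³ = 1 + 3/η² - 4/η³`. -/
theorem liftoff_farfield_identity {η : ℝ} (hη : η ≠ 0) :
    (η ^ 3 + 3 * η - 4) / η ^ 3 = 1 + 3 / η ^ 2 - 4 / η ^ 3 := by
  field_simp

/-- `Q/η³ - 1 = (3η - 4)/η³`. -/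
theorem liftoff_farfield_sub_one {η : ℝ} (hη : η ≠ 0) :
    (η ^ 3 + 3 * η - 4) / η ^ 3 - 1 = (3 * η - 4) / η ^ 3 := by
  field_simp
  ring

/-- upper far-field bound: `Q/η³ - 1 ≤ 3/η²` for every `η > 0` (the defect is `4/η³ ≥ 0`). -/
theorem liftoff_farfield_sub_one_le {η : ℝ} (hη : 0 < η) :
    (η ^ 3 + 3 * η - 4) / η ^ 3 - 1 ≤ 3 / η ^ 2 := by
  have hne : η ≠ 0 := hη.ne'
  have key : 3 / η ^ 2 - ((η ^ 3 + 3 * η - 4) / η ^ 3 - 1) = 4 / η ^ 3 := by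
    field_simp
    ring
  have h4 : 0 ≤ 4 / η ^ 3 := div_nonneg (by norm_num) (pow_pos hη 3).le
  linarith

/-- lower far-field bound: `-3/η² ≤ Q/η³ - 1` as soon as `η ≥ 2/3` (the slack is `(6η-4)/η³`). -/
theorem liftoff_farfield_one_sub_le {η : ℝ} (hη : 2 / 3 ≤ η) :
    -(3 / η ^ 2) ≤ (η ^ 3 + 3 * η - 4) / η ^ 3 - 1 := by
  have hpos : 0 < η := by linarith
  have hne : η ≠ 0 := hpos.ne'
  have key : (η ^ 3 + 3 * η - 4) / η ^ 3 - 1 + 3 / η ^ 2 = (6 * η - 4) / η ^ 3 := by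
    field_simp
    ring
  have h6 : 0 ≤ (6 * η - 4) / η ^ 3 := div_nonneg (by linarith) (pow_pos hpos 3).le
  linarith

/-- **the far-field lemma**: `|Q/η³ - 1| ≤ 3/η²` for `η ≥ 2/3`. -/
theorem liftoff_farfield_abs_le {η : ℝ} (hη : 2 / 3 ≤ η) :
    |(η ^ 3 + 3 * η - 4) / η ^ 3 - 1| ≤ 3 / η ^ 2 :=
  abs_le.mpr ⟨liftoff_farfield_one_sub_le hη, liftoff_farfield_sub_one_le (by linarith)⟩

/-- the threshold `2/3` is sharp: for `0 < η < 2/3` the lower bound fails. -/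
theorem liftoff_farfield_lower_fails {η : ℝ} (h0 : 0 < η) (h1 : η < 2 / 3) :
    (η ^ 3 + 3 * η - 4) / η ^ 3 - 1 < -(3 / η ^ 2) := by
  have hne : η ≠ 0 := h0.ne'
  have key : (η ^ 3 + 3 * η - 4) / η ^ 3 - 1 + 3 / η ^ 2 = (6 * η - 4) / η ^ 3 := by
    field_simp
    ring
  have h6 : (6 * η - 4) / η ^ 3 < 0 := div_neg_of_neg_of_pos (by linarith) (pow_pos h0 3)
  linarith

/-- `Q/η³ = 1` exactly at `η = 4/3` (for `η > 0`). -/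
theorem liftoff_farfield_eq_one_iff {η : ℝ} (hη : 0 < η) :
    (η ^ 3 + 3 * η - 4) / η ^ 3 = 1 ↔ η = 4 / 3 := by
  have hne : η ≠ 0 := hη.ne'
  have h3 : (0 : ℝ) < η ^ 3 := pow_pos hη 3
  constructor
  · intro h
    have h' : (η ^ 3 + 3 * η - 4) / η ^ 3 - 1 = 0 := by rw [h]; ring
    rw [liftoff_farfield_sub_one hne, div_eq_zero_iff] at h'
    rcases h' with h' | h'
    · linarith
    · exact absurd h' h3.ne'
  · intro h
    subst h
    norm_num

/-- the overshoot identity: `5/4 - Q/η³ = (η - 2)²(η + 4)/(4η³)`. -/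
theorem liftoff_farfield_max_identity {η : ℝ} (hη : η ≠ 0) :
    5 / 4 - (η ^ 3 + 3 * η - 4) / η ^ 3 = (η - 2) ^ 2 * (η + 4) / (4 * η ^ 3) := by
  field_simp
  ring

/-- **the far-field factor overshoots**: `Q/η³ ≤ 5/4` for every `η > 0` … -/
theorem liftoff_farfield_le_max {η : ℝ} (hη : 0 < η) :
    (η ^ 3 + 3 * η - 4) / η ^ 3 ≤ 5 / 4 := by
  have key := liftoff_farfield_max_identity hη.ne'
  have hnum : 0 ≤ (η - 2) ^ 2 * (η + 4) := mul_nonneg (sq_nonneg _) (by linarith)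
  have hrhs : 0 ≤ (η - 2) ^ 2 * (η + 4) / (4 * η ^ 3) :=
    div_nonneg hnum (by positivity)
  linarith

/-- … with the value `5/4` attained at `η = 2` … -/
theorem liftoff_farfield_at_two : ((2 : ℝ) ^ 3 + 3 * 2 - 4) / 2 ^ 3 = 5 / 4 := by norm_num

/-- … and only there. -/
theorem liftoff_farfield_eq_max_iff {η : ℝ} (hη : 0 < η) :
    (η ^ 3 + 3 * η - 4) / η ^ 3 = 5 / 4 ↔ η = 2 := by
  constructor
  · intro h
    have key := liftoff_farfield_max_identity hη.ne'
    rw [h, sub_self] at key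
    have hden : (4 * η ^ 3) ≠ 0 := by positivity
    have hnum : (η - 2) ^ 2 * (η + 4) = 0 := by
      rcases (div_eq_zero_iff.mp key.symm) with h1 | h1
      · exact h1
      · exact absurd h1 hden
    rcases mul_eq_zero.mp hnum with h2 | h2
    · have := pow_eq_zero_iff (n := 2) (by norm_num) |>.mp h2
      linarith
    · linarith
  · intro h
    subst h
    norm_num

/-- value at the contact: `Q(1)/1³ = 0`. -/
theorem liftoff_farfield_at_contact : ((1 : ℝ) ^ 3 + 3 * 1 - 4) / 1 ^ 3 = 0 := by norm_num

/-- `Q/η³` is increasing on `(0, 2]`: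
`Q(t)/t³ - Q(s)/s³ = (t - s)(4(t - s)² + 3st(4 - t - s))/(s³t³) ≥ 0` for `0 < s ≤ t ≤ 2`. -/
theorem liftoff_farfield_mono_left {s t : ℝ} (hs : 0 < s) (hst : s ≤ t) (ht : t ≤ 2) :
    (s ^ 3 + 3 * s - 4) / s ^ 3 ≤ (t ^ 3 + 3 * t - 4) / t ^ 3 := by
  have ht0 : 0 < t := lt_of_lt_of_le hs hst
  have hsne : s ≠ 0 := hs.ne'
  have htne : t ≠ 0 := ht0.ne'
  have key : (t ^ 3 + 3 * t - 4) / t ^ 3 - (s ^ 3 + 3 * s - 4) / s ^ 3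
      = (t - s) * (4 * (t - s) ^ 2 + 3 * s * t * (4 - t - s)) / (s ^ 3 * t ^ 3) := by
    field_simp
    ring
  have hnum : 0 ≤ (t - s) * (4 * (t - s) ^ 2 + 3 * s * t * (4 - t - s)) := by
    apply mul_nonneg (by linarith)
    have h1 : 0 ≤ 4 * (t - s) ^ 2 := by positivity
    have h2 : 0 ≤ 3 * s * t * (4 - t - s) :=
      mul_nonneg (mul_nonneg (mul_nonneg (by norm_num) hs.le) ht0.le) (by linarith)
    linarith
  have hfrac : 0 ≤ (t - s) * (4 * (t - s) ^ 2 + 3 * s * t * (4 - t - s)) / (s ^ 3 * t ^ 3) :=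
    div_nonneg hnum (by positivity)
  linarith

/-- `Q/η³` is decreasing on `[2, ∞)` (to its limit `1` from above):
`Q(s)/s³ - Q(t)/t³ = (t - s)((3s - 6)(t² + st) + 2(t - s)(t + 2s))/(s³t³) ≥ 0` for `2 ≤ s ≤ t`. -/
theorem liftoff_farfield_anti_right {s t : ℝ} (hs : 2 ≤ s) (hst : s ≤ t) :
    (t ^ 3 + 3 * t - 4) / t ^ 3 ≤ (s ^ 3 + 3 * s - 4) / s ^ 3 := by
  have hs0 : 0 < s := by linarith
  have ht0 : 0 < t := by linarith
  have hsne : s ≠ 0 := hs0.ne'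
  have htne : t ≠ 0 := ht0.ne'
  have key : (s ^ 3 + 3 * s - 4) / s ^ 3 - (t ^ 3 + 3 * t - 4) / t ^ 3
      = (t - s) * ((3 * s - 6) * (t ^ 2 + s * t) + 2 * (t - s) * (t + 2 * s)) / (s ^ 3 * t ^ 3) := by
    field_simp
    ring
  have hnum : 0 ≤ (t - s) * ((3 * s - 6) * (t ^ 2 + s * t) + 2 * (t - s) * (t + 2 * s)) := by
    apply mul_nonneg (by linarith)
    have h1 : 0 ≤ (3 * s - 6) * (t ^ 2 + s * t) := mul_nonneg (by linarith) (by positivity)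
    have h2 : 0 ≤ 2 * (t - s) * (t + 2 * s) := mul_nonneg (by linarith) (by linarith)
    linarith
  have hfrac : 0 ≤ (t - s) * ((3 * s - 6) * (t ^ 2 + s * t) + 2 * (t - s) * (t + 2 * s))
      / (s ^ 3 * t ^ 3) := div_nonneg hnum (by positivity)
  linarith

/-- beyond the maximum the factor stays above its limit: `1 < Q/η³` for `η > 4/3`,
in particular on `[2, ∞)`. -/
theorem liftoff_farfield_gt_one {η : ℝ} (hη : 4 / 3 < η) :
    1 < (η ^ 3 + 3 * η - 4) / η ^ 3 := by
  have h0 : 0 < η := by linarith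
  have key := liftoff_farfield_sub_one h0.ne'
  have hpos : 0 < (3 * η - 4) / η ^ 3 := div_pos (by linarith) (pow_pos h0 3)
  linarith

/-! ## B. Bounded members of the homogeneous family of `m''' = m` vanish -/

/-- `sin (n · 2π) = 0` for natural `n`. -/
theorem sin_nat_mul_two_pi_eq_zero (n : ℕ) : sin ((n : ℝ) * (2 * π)) = 0 := by
  have : (n : ℝ) * (2 * π) = ((2 * n : ℕ) : ℝ) * π := by push_cast; ring
  rw [this, sin_nat_mul_pi]

/-- `√3 > 0`. -/
theorem sqrt_three_pos : 0 < sqrt 3 := Real.sqrt_pos.mpr (by norm_num)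

/-- `√3 ≤ 2`. -/
theorem sqrt_three_le_two : sqrt 3 ≤ 2 := by
  have h := Real.sq_sqrt (show (0 : ℝ) ≤ 3 by norm_num)
  nlinarith [Real.sqrt_nonneg 3]

/-- Step 1: boundedness on `ℝ` forces the coefficient of `e^{η}` to vanish. -/
theorem smoothing_hom_bounded_a {a b c M : ℝ}
    (hM : ∀ η : ℝ,
      |a * exp η + exp (-η / 2) * (b * cos (sqrt 3 / 2 * η) + c * sin (sqrt 3 / 2 * η))| ≤ M) :
    a = 0 := by
  by_contra ha
  have hapos : 0 < |a| := abs_pos.mpr ha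
  have hM0 : 0 ≤ M := le_trans (abs_nonneg _) (hM 0)
  -- on η ≥ 0 the oscillatory part is bounded by |b| + |c|
  have hbound : ∀ η : ℝ, 0 ≤ η → |a| * exp η ≤ M + |b| + |c| := by
    intro η hη
    set T := exp (-η / 2) * (b * cos (sqrt 3 / 2 * η) + c * sin (sqrt 3 / 2 * η)) with hT
    have hexp : exp (-η / 2) ≤ 1 := by
      have : exp (-η / 2) ≤ exp 0 := exp_le_exp.mpr (by linarith)
      simpa using this
    have htrig : |b * cos (sqrt 3 / 2 * η) + c * sin (sqrt 3 / 2 * η)| ≤ |b| + |c| := by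
      have h1 := abs_add_le (b * cos (sqrt 3 / 2 * η)) (c * sin (sqrt 3 / 2 * η))
      rw [abs_mul, abs_mul] at h1
      have hc := abs_cos_le_one (sqrt 3 / 2 * η)
      have hs := abs_sin_le_one (sqrt 3 / 2 * η)
      have h2 : |b| * |cos (sqrt 3 / 2 * η)| ≤ |b| := by
        simpa using mul_le_mul_of_nonneg_left hc (abs_nonneg b)
      have h3 : |c| * |sin (sqrt 3 / 2 * η)| ≤ |c| := by
        simpa using mul_le_mul_of_nonneg_left hs (abs_nonneg c)
      linarith
    have hTle : |T| ≤ |b| + |c| := by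
      rw [hT, abs_mul, abs_of_pos (exp_pos _)]
      calc exp (-η / 2) * |b * cos (sqrt 3 / 2 * η) + c * sin (sqrt 3 / 2 * η)|
          ≤ 1 * (|b| + |c|) :=
            mul_le_mul hexp htrig (abs_nonneg _) (by norm_num)
        _ = |b| + |c| := one_mul _
    have hsplit : |a * exp η| ≤ |a * exp η + T| + |T| := by
      have := abs_add_le (a * exp η + T) (-T)
      simpa [abs_neg, add_neg_cancel_right] using this
    have hval : |a * exp η| = |a| * exp η := by rw [abs_mul, abs_of_pos (exp_pos η)]
    have := hM η
    linarith
  -- evaluate at η₀ = (M + |b| + |c|)/|a| + 1, where e^{η₀} ≥ η₀ + 1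
  set K := M + |b| + |c| with hK
  have hK0 : 0 ≤ K := by rw [hK]; positivity
  have hη0 : 0 ≤ K / |a| + 1 := by positivity
  have h1 := hbound (K / |a| + 1) hη0
  have h2 : K / |a| + 1 + 1 ≤ exp (K / |a| + 1) := add_one_le_exp _
  have h3 : |a| * (K / |a| + 1 + 1) ≤ |a| * exp (K / |a| + 1) :=
    mul_le_mul_of_nonneg_left h2 hapos.le
  have h4 : |a| * (K / |a| + 1 + 1) = K + 2 * |a| := by
    field_simp
    ring
  linarith

/-- Step 2: with `a = 0`, boundedness forces `b = 0` (evaluate at `η = -4πn/√3`, where the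
phase `√3η/2 = -2πn`: `cos = 1`, `sin = 0`, and `e^{-η/2} = e^{2πn/√3} ≥ 1 + n`). -/
theorem smoothing_hom_bounded_b {b c M : ℝ}
    (hM : ∀ η : ℝ, |exp (-η / 2) * (b * cos (sqrt 3 / 2 * η) + c * sin (sqrt 3 / 2 * η))| ≤ M) :
    b = 0 := by
  by_contra hb
  have hbpos : 0 < |b| := abs_pos.mpr hb
  obtain ⟨n, hn⟩ := exists_nat_gt (M / |b|)
  have hs0 := sqrt_three_pos
  have hs2 := sqrt_three_le_two
  have hsne : sqrt 3 ≠ 0 := hs0.ne'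
  set η : ℝ := -(4 * π * n / sqrt 3) with hη
  have hphase : sqrt 3 / 2 * η = -((n : ℝ) * (2 * π)) := by
    rw [hη]; field_simp; ring
  have hcos : cos (sqrt 3 / 2 * η) = 1 := by rw [hphase, cos_neg, cos_nat_mul_two_pi]
  have hsin : sin (sqrt 3 / 2 * η) = 0 := by rw [hphase, sin_neg, sin_nat_mul_two_pi_eq_zero, neg_zero]
  have harg : -η / 2 = 2 * π * n / sqrt 3 := by rw [hη]; field_simp; ring
  have hval : |exp (-η / 2) * (b * cos (sqrt 3 / 2 * η) + c * sin (sqrt 3 / 2 * η))|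
      = exp (2 * π * n / sqrt 3) * |b| := by
    rw [hcos, hsin, harg, mul_one, mul_zero, add_zero, abs_mul, abs_of_pos (exp_pos _)]
  have hle : exp (2 * π * n / sqrt 3) * |b| ≤ M := by rw [← hval]; exact hM η
  -- lower bound: the exponent is ≥ n
  have hn0 : (0 : ℝ) ≤ n := Nat.cast_nonneg n
  have hexparg : (n : ℝ) ≤ 2 * π * n / sqrt 3 := by
    have hmul : (2 * π * n / sqrt 3) * sqrt 3 = 2 * π * n := by field_simp
    by_contra hlt
    push Not at hlt
    nlinarith [pi_gt_three, mul_lt_mul_of_pos_right hlt hs0]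
  have hexp : (n : ℝ) + 1 ≤ exp (2 * π * n / sqrt 3) :=
    le_trans (by linarith) (add_one_le_exp _)
  have h5 : (n + 1) * |b| ≤ exp (2 * π * n / sqrt 3) * |b| :=
    mul_le_mul_of_nonneg_right hexp (abs_nonneg b)
  have h6 : M < n * |b| := by
    have := (div_lt_iff₀ hbpos).mp hn
    linarith
  nlinarith

/-- Step 3: with `a = b = 0`, boundedness forces `c = 0` (evaluate at `η = (π - 4πn)/√3`, where
the phase is `π/2 - 2πn`: `sin = 1`, `cos = 0`, and `e^{-η/2} = e^{(4n-1)π/(2√3)} ≥ 1 + n`). -/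
theorem smoothing_hom_bounded_c {c M : ℝ}
    (hM : ∀ η : ℝ, |exp (-η / 2) * (c * sin (sqrt 3 / 2 * η))| ≤ M) :
    c = 0 := by
  by_contra hc
  have hcpos : 0 < |c| := abs_pos.mpr hc
  obtain ⟨n, hn⟩ := exists_nat_gt (M / |c| + 1)
  have hs0 := sqrt_three_pos
  have hs2 := sqrt_three_le_two
  have hsne : sqrt 3 ≠ 0 := hs0.ne'
  have hM0 : 0 ≤ M := le_trans (abs_nonneg _) (hM 0)
  have hn1 : (1 : ℝ) ≤ n := by
    have : 0 ≤ M / |c| := div_nonneg hM0 hcpos.le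
    linarith
  set η : ℝ := (π - 4 * π * n) / sqrt 3 with hη
  have hphase : sqrt 3 / 2 * η = π / 2 - (n : ℝ) * (2 * π) := by
    rw [hη]; field_simp; ring
  have hsin : sin (sqrt 3 / 2 * η) = 1 := by
    rw [hphase, sin_sub, sin_pi_div_two, cos_pi_div_two, cos_nat_mul_two_pi,
      sin_nat_mul_two_pi_eq_zero]
    ring
  have harg : -η / 2 = (4 * n - 1) * π / (2 * sqrt 3) := by rw [hη]; field_simp; ring
  have hval : |exp (-η / 2) * (c * sin (sqrt 3 / 2 * η))| = exp ((4 * n - 1) * π / (2 * sqrt 3)) * |c| := by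
    rw [hsin, harg, mul_one, abs_mul, abs_of_pos (exp_pos _)]
  have hle : exp ((4 * n - 1) * π / (2 * sqrt 3)) * |c| ≤ M := by rw [← hval]; exact hM η
  have hexparg : (n : ℝ) ≤ (4 * n - 1) * π / (2 * sqrt 3) := by
    have hmul : ((4 * n - 1) * π / (2 * sqrt 3)) * (2 * sqrt 3) = (4 * n - 1) * π := by
      field_simp
    by_contra hlt
    push Not at hlt
    have h2s : 0 < 2 * sqrt 3 := by positivity
    nlinarith [pi_gt_three, mul_lt_mul_of_pos_right hlt h2s]
  have hexp : (n : ℝ) + 1 ≤ exp ((4 * n - 1) * π / (2 * sqrt 3)) :=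
    le_trans (by linarith) (add_one_le_exp _)
  have h5 : (n + 1) * |c| ≤ exp ((4 * n - 1) * π / (2 * sqrt 3)) * |c| :=
    mul_le_mul_of_nonneg_right hexp (abs_nonneg c)
  have h6 : M < n * |c| := by
    have := (div_lt_iff₀ hcpos).mp (show M / |c| < n by linarith)
    linarith
  nlinarith

/-- **Uniqueness of the bounded smoothing inverse (within the explicit solution family).**
If `η ↦ a e^{η} + e^{-η/2}(b cos(√3η/2) + c sin(√3η/2))` is bounded on `ℝ` then `a = b = c = 0`. -/
theorem smoothing_hom_bounded_zero {a b c : ℝ}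
    (h : ∃ M : ℝ, ∀ η : ℝ,
      |a * exp η + exp (-η / 2) * (b * cos (sqrt 3 / 2 * η) + c * sin (sqrt 3 / 2 * η))| ≤ M) :
    a = 0 ∧ b = 0 ∧ c = 0 := by
  obtain ⟨M, hM⟩ := h
  have ha : a = 0 := smoothing_hom_bounded_a hM
  have hM' : ∀ η : ℝ,
      |exp (-η / 2) * (b * cos (sqrt 3 / 2 * η) + c * sin (sqrt 3 / 2 * η))| ≤ M := by
    intro η
    have := hM η
    rwa [ha, zero_mul, zero_add] at this
  have hb : b = 0 := smoothing_hom_bounded_b hM'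
  have hM'' : ∀ η : ℝ, |exp (-η / 2) * (c * sin (sqrt 3 / 2 * η))| ≤ M := by
    intro η
    have := hM' η
    rwa [hb, zero_mul, zero_add] at this
  exact ⟨ha, hb, smoothing_hom_bounded_c hM''⟩

/-- Contrapositive in the form used by kernel #112: a nontrivial member of the family is
unbounded on `ℝ` — so two bounded solutions of `m - m''' = f` differing by a member of the
family are equal. -/
theorem smoothing_hom_unbounded {a b c : ℝ} (h : a ≠ 0 ∨ b ≠ 0 ∨ c ≠ 0) (M : ℝ) :
    ∃ η : ℝ,
      M < |a * exp η + exp (-η / 2) * (b * cos (sqrt 3 / 2 * η) + c * sin (sqrt 3 / 2 * η))| := by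
  by_contra hcon
  push Not at hcon
  obtain ⟨ha, hb, hc⟩ := smoothing_hom_bounded_zero ⟨M, hcon⟩
  rcases h with h | h | h
  · exact h ha
  · exact h hb
  · exact h hc

end Summit.AnomalousDissipation.AnomalousDissipation.Theorems
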